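import Literature.AlgebraicGeometry.Resolution.BlowupsFlatBaseChange
import Literature.AlgebraicGeometry.Resolution.BlowupPrincipalCharts
import Literature.AlgebraicGeometry.Resolution.BlowupChartRsop
import Literature.AlgebraicGeometry.Resolution.ProOpenIdealExtension
import Literature.AlgebraicGeometry.Resolution.IdealSheafLemmas
import HarnessLib

/-!
# The local rings of a blowing up are localizations of the charts of `Bl_{J_s}(Spec 𝒪_{X,s})`

Topic: `Literature/AlgebraicGeometry/Resolution`. For a blowing up `π : X' → X` in the sense of
the universal property (`IsBlowup π J`, `Blowups.lean`; Görtz–Wedhorn I, Def. 13.90) of an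
ARBITRARY scheme `X` along an arbitrary quasi-coherent ideal sheaf `J`, and a point `x' ∈ X'`
over `s = π x'`, the local ring `𝒪_{X',x'}` is a localization of a chart ring of the blowing up of
the LOCAL scheme `Spec 𝒪_{X,s}` along the stalk `J_s ⊆ 𝒪_{X,s}`: if `J_s = (c₁, …, c_k)`, then
for some `j` there are a prime `𝔴` of the chart ring `B_j = (𝒪_{X,s}[J_s t])_{(c_j t)}`
(`= 𝒪_{X,s}[J_s/c_j]`, Stacks 0804; `chartRing c j` of `BlowupChartRsop.lean`, the chart of
`AffineBlowup.lean`) and a ring homomorphism `χ : B_j → 𝒪_{X',x'}` which, composed with the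
structure map `chartBase c j : 𝒪_{X,s} → B_j` (`reesChartBase`), is the stalk map `π_{x'}^♯`,
and which presents `𝒪_{X',x'}` as the localization `(B_j)_𝔴` (`IsBlowup.exists_reesChart_stalk`).
This is the dictionary through which chart-level commutative algebra (`BlowupChartRsop.lean`:
`isRsopPart_chartFamily_reesChart` is stated for any localization `L` of `chartRing c i` at a
prime over `𝔪`; `BlowupChartRegular.lean`, `HypersurfaceTransformChart.lean`, …) is read off at
the points of an abstract blowing up — node F7 (scheme half) of the chart computation behind
de Jong 1996, 2.4 (`DeJong1996NormalCrossingsBlowupStep`, `NormalCrossingsStrictification.lean`).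
All PROVED:

* `germ_ΓSpecIso_inv_apply_eq_stalkMap` — for `φ : 𝒪_{X,x} → B` and `𝔴 ∈ Spec B` over
  `x`, the stalk map of `Spec B → Spec 𝒪_{X,x} → X` at `𝔴`, read on `𝒪_{X,x}`, is `φ`
  followed by `B ≅ Γ(Spec B) → 𝒪_{Spec B,𝔴} = B_𝔴` (Mathlib `Scheme.fromSpecStalk_app`);
  bookkeeping `stalkSpecializes_self_apply` (elementwise form of Mathlib
  `TopCat.Presheaf.stalkSpecializes_refl`), `stalkCongr_hom_…_apply` (loops of stalk
  isomorphisms between equal points are the identity),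
  `comap_fromSpecStalk_eq_affineBlowupIdealSheaf` (`ι⁻¹J · 𝒪 = (J_s)~` in the form
  `affineBlowup.idealSheaf J_s`; cf. `comap_fromSpecStalk_eq_ofIdealTop` of
  `AlterationsNormalFormBlowupFormal.lean`).
* `exists_stalk_ringHom_of_chart` — if `q : Spec B → X'` sends `𝔴 ↦ x'`, is an isomorphism on
  the local rings there, and `q ≫ π = Spec φ ≫ (Spec 𝒪_{X,s} → X)`, then
  `χ = (B → B_𝔴 ≅ 𝒪_{X',x'})` satisfies `χ ∘ φ = π^♯_{x'}`, presents `𝒪_{X',x'}` as `B_𝔴`, and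
  `𝔴 ∩ 𝒪_{X,s} = 𝔪_s`.
* `IsBlowup.exists_chart_morphism` — **every point of a blowing up has such a chart**
  `q : Spec B_j → X'` through it: blowing ups commute with the flat base change
  `ι : Spec 𝒪_{X,s} → X` (`IsBlowup.pullback_snd_of_flat`, `flat_fromSpecStalk`), and
  `ι⁻¹J · 𝒪 = (J_s)~`, so by uniqueness of blowing ups (`IsBlowup.unique`,
  `affineBlowup.isBlowup`) the base change
  `X' ×_X Spec 𝒪_{X,s}` is `Proj 𝒪_{X,s}[J_s t]`, covered by the charts `Spec B_j`
  (`affineBlowup.iSup_chartOpen_eq_top`); `x'` lifts to the base change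
  (`mem_range_pullback_fst_fromSpecStalk_of_eq`), whose projection to `X'` is an isomorphism on
  local rings (`isIso_stalkMap_pullback_fst_fromSpecStalk`).
* `IsBlowup.exists_reesChart_stalk` — the statement of the first paragraph (the two combined;
  the stalks of `Spec B_j` are the localizations of `B_j`, Mathlib
  `StructureSheaf.IsLocalization.to_stalk`).

## Sources

* The Stacks Project, Tag 0804 (the charts `Spec A[I/a]` of a blowing up), Tag 0805 (blowing
  up commutes with flat base change), Tag 01J7 (`Spec 𝒪_{X,x} → X`). [StacksProject]
* U. Görtz, T. Wedhorn, *Algebraic Geometry I*, 2nd ed. (2020), Def. 13.90, Prop. 13.91,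
  Prop. 13.92. [GortzWedhorn2020]
-/

noncomputable section

open CategoryTheory CategoryTheory.Limits AlgebraicGeometry TopologicalSpace IsLocalRing
  HomogeneousLocalization

namespace Literature.AlgebraicGeometry.Resolution

open Scheme.IdealSheafData

universe u

/-! ## The stalk map of `Spec B → Spec 𝒪_{X,x} → X` -/

section SpecStalk

/-- In a presheaf, the specialization map of a point to itself is the identity on elements,
for any proof of `x ⤳ x`: elementwise form of Mathlib's `TopCat.Presheaf.stalkSpecializes_refl`.
[folklore] -/
theorem stalkSpecializes_self_apply {T : TopCat.{u}} (F : TopCat.Presheaf CommRingCat.{u} T)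
    (x : T) (h : x ⤳ x) (t : F.stalk x) : F.stalkSpecializes h t = t := by
  rw [TopCat.Presheaf.stalkSpecializes_refl F x, CommRingCat.id_apply]

/-- Going around a loop of stalk isomorphisms between inseparable points is the identity.
[folklore] -/
theorem stalkCongr_hom_stalkCongr_hom_apply {T : TopCat.{u}} (F : TopCat.Presheaf CommRingCat.{u} T)
    {x y : T} (e₁ : Inseparable x y) (e₂ : Inseparable y x) (t : F.stalk x) :
    (F.stalkCongr e₂).hom ((F.stalkCongr e₁).hom t) = t := by
  rw [TopCat.Presheaf.stalkCongr_hom, TopCat.Presheaf.stalkCongr_hom,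
    TopCat.Presheaf.stalkSpecializes_comp_apply]
  exact stalkSpecializes_self_apply F x _ t

/-- Going around a loop of three stalk isomorphisms between inseparable points is the identity.
[folklore] -/
theorem stalkCongr_hom_stalkCongr_hom_stalkCongr_hom_apply {T : TopCat.{u}}
    (F : TopCat.Presheaf CommRingCat.{u} T) {x y z : T} (e₁ : Inseparable x y)
    (e₂ : Inseparable y z) (e₃ : Inseparable z x) (t : F.stalk x) :
    (F.stalkCongr e₃).hom ((F.stalkCongr e₂).hom ((F.stalkCongr e₁).hom t)) = t := by
  rw [TopCat.Presheaf.stalkCongr_hom, TopCat.Presheaf.stalkCongr_hom,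
    TopCat.Presheaf.stalkCongr_hom, TopCat.Presheaf.stalkSpecializes_comp_apply,
    TopCat.Presheaf.stalkSpecializes_comp_apply]
  exact stalkSpecializes_self_apply F x _ t

/-- **The structure map of `Spec B → Spec 𝒪_{X,x} → X` on stalks.** For a ring map
`φ : 𝒪_{X,x} → B` and a point `𝔴 ∈ Spec B` lying over `x` (`x = (Spec φ ≫ ι)(𝔴)`,
`ι : Spec 𝒪_{X,x} → X`), the stalk map of `Spec φ ≫ ι` at `𝔴`, read on `𝒪_{X,x}`, is `φ`
followed by `B ≅ Γ(Spec B) → 𝒪_{Spec B, 𝔴}` (checked on germs: `ι^*` on a neighbourhood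
`U ∋ x` is the germ map followed by `𝒪_{X,x} ≅ Γ(Spec 𝒪_{X,x})`, Mathlib
`Scheme.fromSpecStalk_app`). [folklore] -/
theorem germ_ΓSpecIso_inv_apply_eq_stalkMap {Y : Scheme.{u}} (x : Y) {B : CommRingCat.{u}}
    (φ : Y.presheaf.stalk x ⟶ B) (w : Spec B) (H : x = (Spec.map φ ≫ Y.fromSpecStalk x) w)
    (a : Y.presheaf.stalk x) :
    (Spec B).presheaf.germ ⊤ w trivial ((Scheme.ΓSpecIso B).inv (φ a)) =
      (Spec.map φ ≫ Y.fromSpecStalk x).stalkMap w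
        ((Y.presheaf.stalkCongr (Inseparable.of_eq H)).hom a) := by
  obtain ⟨U, hxU, f, rfl⟩ := Y.presheaf.exists_germ_eq a
  -- the right-hand side: the germ at `𝔴` of the pulled-back section
  rw [TopCat.Presheaf.stalkCongr_hom, TopCat.Presheaf.germ_stalkSpecializes_apply,
    Scheme.Hom.germ_stalkMap_apply, Scheme.Hom.comp_app]
  erw [CommRingCat.comp_apply]
  -- `ι^*` on `U` is the germ map followed by `𝒪_{X,x} ≅ Γ(Spec 𝒪_{X,x})` and restriction
  erw [Scheme.fromSpecStalk_app hxU, CommRingCat.comp_apply, CommRingCat.comp_apply]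
  -- naturality of `(Spec φ)^*` with respect to restriction, then `germ ∘ res = germ`
  have h2 := ConcreteCategory.congr_hom ((Spec.map φ).naturality
    (homOfLE (le_top : (Y.fromSpecStalk x) ⁻¹ᵁ U ≤ ⊤)).op)
    ((Scheme.ΓSpecIso (Y.presheaf.stalk x)).inv (Y.presheaf.germ U x hxU f))
  simp only [CommRingCat.comp_apply] at h2
  erw [h2]
  erw [TopCat.Presheaf.germ_res_apply]
  -- `(Spec φ)^* ∘ (𝒪_{X,x} ≅ Γ) = (B ≅ Γ) ∘ φ`
  have h3 := ConcreteCategory.congr_hom (Scheme.ΓSpecIso_inv_naturality φ)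
    (Y.presheaf.germ U x hxU f)
  simp only [CommRingCat.comp_apply] at h3
  erw [← h3]
  rfl

/-- **A chart through a point computes its local ring.** Let `π : X' → X`, `x' ∈ X'`,
`s = π x'`, `φ : 𝒪_{X,s} → B` a ring map and `q : Spec B → X'` a morphism with `q 𝔴 = x'`,
inducing an isomorphism `𝒪_{X',x'} ≅ B_𝔴` on local rings at `𝔴`, and lying over
`Spec φ : Spec B → Spec 𝒪_{X,s}` (`q ≫ π = Spec φ ≫ (Spec 𝒪_{X,s} → X)`). Then the ring map
`χ : B → B_𝔴 ≅ 𝒪_{X',x'}` satisfies `χ ∘ φ = π^♯_{x'}`, presents `𝒪_{X',x'}` as the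
localization of `B` at `𝔴`, and `𝔴` lies over the maximal ideal of `𝒪_{X,s}`. [folklore] -/
theorem exists_stalk_ringHom_of_chart {X' X : Scheme.{u}} (π : X' ⟶ X) (x' : X')
    {B : CommRingCat.{u}} (φ : X.presheaf.stalk (π x') ⟶ B) (q : Spec B ⟶ X') (w : Spec B)
    (hq : q w = x') [IsIso (q.stalkMap w)]
    (hsq : q ≫ π = Spec.map φ ≫ X.fromSpecStalk (π x')) :
    ∃ χ : B →+* X'.presheaf.stalk x',
      (∀ a, χ (φ.hom a) = (π.stalkMap x').hom a) ∧
      @IsLocalization.AtPrime _ _ (X'.presheaf.stalk x') _ χ.toAlgebra w.asIdeal _ ∧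
      w.asIdeal.comap φ.hom = maximalIdeal (X.presheaf.stalk (π x')) := by
  have H : π x' = (Spec.map φ ≫ X.fromSpecStalk (π x')) w := by
    rw [← hsq, Scheme.Hom.comp_apply, hq]
  -- `τ : B ≅ Γ(Spec B) → 𝒪_{Spec B, 𝔴}`, `χ = τ ≫ (𝒪_{Spec B, 𝔴} ≅ 𝒪_{X', q 𝔴} ≅ 𝒪_{X', x'})`
  let τ : B ⟶ (Spec B).presheaf.stalk w :=
    (Scheme.ΓSpecIso B).inv ≫ (Spec B).presheaf.germ ⊤ w trivial
  let χ₀ : (Spec B).presheaf.stalk w ⟶ X'.presheaf.stalk x' :=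
    inv (q.stalkMap w) ≫ (X'.presheaf.stalkCongr (.of_eq hq)).hom
  let χ : B ⟶ X'.presheaf.stalk x' := τ ≫ χ₀
  -- compatibility with `π^♯_{x'}`: a loop of specialization maps between equal points
  have hinv : ∀ t, inv (q.stalkMap w) (q.stalkMap w t) = t := fun t => by
    rw [← CommRingCat.comp_apply, IsIso.hom_inv_id, CommRingCat.id_apply]
  have hcomp : ∀ a, χ.hom (φ.hom a) = (π.stalkMap x').hom a := by
    intro a
    change (X'.presheaf.stalkCongr (.of_eq hq)).hom (inv (q.stalkMap w)
      ((Spec B).presheaf.germ ⊤ w trivial ((Scheme.ΓSpecIso B).inv (φ a)))) = _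
    rw [germ_ΓSpecIso_inv_apply_eq_stalkMap (π x') φ w H a]
    have e2 := ConcreteCategory.congr_hom
      (Scheme.Hom.stalkMap_congr_hom (Spec.map φ ≫ X.fromSpecStalk (π x')) (q ≫ π) hsq.symm w)
      ((X.presheaf.stalkCongr (Inseparable.of_eq H)).hom a)
    rw [CommRingCat.comp_apply] at e2
    have e3 : ∀ t, (q ≫ π).stalkMap w t = q.stalkMap w (π.stalkMap (q w) t) := fun t =>
      ConcreteCategory.congr_hom (Scheme.Hom.stalkMap_comp q π w) t
    rw [e2, e3, hinv]
    have h' := ConcreteCategory.congr_hom (Scheme.Hom.stalkMap_congr_point π (q w) x' hq)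
    simp only [CommRingCat.comp_apply] at h'
    rw [h']
    exact congrArg _ (stalkCongr_hom_stalkCongr_hom_stalkCongr_hom_apply X.presheaf _ _ _ a)
  -- the localization: `𝒪_{Spec B, 𝔴} = B_𝔴`, transported along `χ₀`
  letI : Algebra B (X'.presheaf.stalk x') := χ.hom.toAlgebra
  letI : Algebra B ((Spec B).presheaf.stalk w) := τ.hom.toAlgebra
  have hloc : IsLocalization.AtPrime ((Spec B).presheaf.stalk w) w.asIdeal :=
    StructureSheaf.IsLocalization.to_stalk (R := B) w
  let ε : (Spec B).presheaf.stalk w ≃ₐ[B] X'.presheaf.stalk x' :=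
    AlgEquiv.ofRingEquiv (f := ((asIso (q.stalkMap w)).symm ≪≫
      X'.presheaf.stalkCongr (.of_eq hq)).commRingCatIsoToRingEquiv) fun b => rfl
  haveI hloc' : IsLocalization.AtPrime (X'.presheaf.stalk x') w.asIdeal :=
    IsLocalization.isLocalization_of_algEquiv w.asIdeal.primeCompl ε
  refine ⟨χ.hom, hcomp, hloc', ?_⟩
  -- `𝔴` lies over the maximal ideal: both `B → 𝒪_{X',x'}` and `π^♯_{x'}` detect units
  ext a
  rw [Ideal.mem_comap, ← IsLocalization.AtPrime.to_map_mem_maximal_iff (X'.presheaf.stalk x')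
    w.asIdeal (φ.hom a), RingHom.algebraMap_toAlgebra, hcomp a, IsLocalRing.mem_maximalIdeal,
    IsLocalRing.mem_maximalIdeal, mem_nonunits_iff, mem_nonunits_iff, isUnit_map_iff]

end SpecStalk

/-! ## Charts of a blowing up through a point -/

section Chart

variable {X' X : Scheme.{u}} {π : X' ⟶ X} {J : X.IdealSheafData}

/-- The inverse image of `J` along `ι : Spec 𝒪_{X,s} → X` is the ideal sheaf `(J_s)~` of the
stalk, in the form used by `affineBlowup` (cf. `comap_fromSpecStalk_eq_ofIdealTop`). [folklore] -/
theorem comap_fromSpecStalk_eq_affineBlowupIdealSheaf (J : X.IdealSheafData) (s : X) :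
    J.comap (X.fromSpecStalk s) = affineBlowup.idealSheaf (stalkIdeal J s) := by
  obtain ⟨U, hU, hxU, -⟩ :=
    exists_isAffineOpen_mem_and_subset (X := X) (x := s) (U := ⊤) (Opens.mem_top _)
  refine Scheme.IdealSheafData.ext_of_isAffine ?_
  rw [affineBlowup.idealSheaf, ideal_ofIdealTop_top,
    ideal_comap_of_le (X.fromSpecStalk s) J ⟨U, hU⟩ ⟨⊤, isAffineOpen_top _⟩
      (top_le_preimage_fromSpecStalk s U hxU),
    appLE_fromSpecStalk_top s U hxU, stalkIdeal_eq_map_germ J ⟨U, hU⟩ hxU, Ideal.map_map]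
  rfl

set_option maxHeartbeats 800000 in
-- the comparison with `Proj` over `Spec 𝒪_{X,s}` elaborates large terms
/-- **Every point of a blowing up lies on a chart `Spec B_j → X'` computing its local ring.**
Let `π : X' → X` be a blowing up along `J` (`IsBlowup π J`), `x' ∈ X'`, `s = π x'`, and
`c₁, …, c_k ∈ 𝒪_{X,s}` generators of `J_s`. Then for some `j` there are a point `𝔴` of the
chart `Spec B_j`, `B_j = (𝒪_{X,s}[J_s t])_{(c_j t)}`, of `Bl_{J_s}(Spec 𝒪_{X,s})` and a morphism
`q : Spec B_j → X'` with `q 𝔴 = x'`, inducing an isomorphism on the local rings at `𝔴`, and lying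
over `Spec B_j → Spec 𝒪_{X,s}`: `q` is the chart `Spec B_j → Proj 𝒪_{X,s}[J_s t]` followed by
the identification of `Proj` with the base change `X' ×_X Spec 𝒪_{X,s}` (blowing ups commute with
flat base change, and are unique) and the projection to `X'` (a pro-open immersion).
[cite: StacksProject, Tag 0804] -/
theorem IsBlowup.exists_chart_morphism (hπ : IsBlowup π J) (x' : X') {k : ℕ}
    (c : Fin k → X.presheaf.stalk (π x'))
    (hc : Ideal.span (Set.range c) = stalkIdeal J (π x')) :
    ∃ (j : Fin k) (w : Spec (.of (chartRing c j))) (q : Spec (.of (chartRing c j)) ⟶ X'),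
      q w = x' ∧ IsIso (q.stalkMap w) ∧
        q ≫ π = Spec.map (CommRingCat.ofHom (chartBase c j)) ≫ X.fromSpecStalk (π x') := by
  classical
  have hcj : ∀ j, c j ∈ Ideal.span (Set.range c) := fun j =>
    Ideal.mem_span_range_self (f := c) (x := j)
  haveI : Flat (X.fromSpecStalk (π x')) := flat_fromSpecStalk X (π x')
  -- the base change `P = X' ×_X Spec 𝒪_{X,s} → Spec 𝒪_{X,s}` is a blowing up along
  -- `(J_s)~ = (c)~`
  have hP : IsBlowup (pullback.snd π (X.fromSpecStalk (π x')))
      (affineBlowup.idealSheaf (Ideal.span (Set.range c))) := by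
    have h := hπ.pullback_snd_of_flat (X.fromSpecStalk (π x'))
    rwa [comap_fromSpecStalk_eq_affineBlowupIdealSheaf, ← hc] at h
  -- hence isomorphic to `Proj 𝒪_{X,s}[J_s t]` over `Spec 𝒪_{X,s}`
  obtain ⟨e, he, -⟩ := (affineBlowup.isBlowup (Ideal.span (Set.range c))).unique hP
  -- the point of `P` over `x'`, moved to `Proj` and into a chart
  obtain ⟨y, hy⟩ :=
    mem_range_pullback_fst_fromSpecStalk_of_eq π (π x') (x' := x') rfl
  obtain ⟨z, rfl⟩ : ∃ z, e.hom z = y := ⟨e.inv y, by simp⟩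
  have hz : z ∈ (⊤ : (affineBlowup (Ideal.span (Set.range c))).Opens) := trivial
  rw [← affineBlowup.iSup_chartOpen_eq_top c rfl] at hz
  obtain ⟨j, hzj⟩ := Opens.mem_iSup.mp hz
  obtain ⟨w, -, rfl⟩ := hzj
  refine ⟨j, w, (affineBlowup.chartι (c j) (hcj j) ≫ e.hom) ≫
    pullback.fst π (X.fromSpecStalk (π x')), hy, ?_, ?_⟩
  · -- isomorphism on local rings: an open immersion followed by a pro-open immersion
    have h1 := isIso_stalkMap_pullback_fst_fromSpecStalk π (π x')
      ((affineBlowup.chartι (c j) (hcj j) ≫ e.hom) w)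
    haveI : IsOpenImmersion (affineBlowup.chartι (c j) (hcj j) ≫ e.hom) := inferInstance
    have h2 : IsIso ((affineBlowup.chartι (c j) (hcj j) ≫ e.hom).stalkMap w) := inferInstance
    rw [Scheme.Hom.stalkMap_comp]
    exact @IsIso.comp_isIso _ _ _ _ _ _ _ h1 h2
  · rw [Category.assoc, pullback.condition, Category.assoc, reassoc_of% he, ← Category.assoc,
      affineBlowup.chartι_π (c j) (hcj j)]

/-- **The local rings of a blowing up are localizations of the charts of the blowing up of
`Spec 𝒪_{X,s}` along `J_s`.** Let `π : X' → X` be a blowing up along the ideal sheaf `J`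
(`IsBlowup π J`), `x' ∈ X'`, `s = π x'`, and `c₁, …, c_k ∈ 𝒪_{X,s}` generators of the stalk
`J_s`. Then for some `j` there are a prime ideal `𝔴` of the chart ring
`B_j = (𝒪_{X,s}[J_s t])_{(c_j t)}` of `Bl_{J_s}(Spec 𝒪_{X,s})` and a ring homomorphism
`χ : B_j → 𝒪_{X',x'}` such that `χ ∘ (𝒪_{X,s} → B_j) = π^♯_{x'}`, `χ` presents `𝒪_{X',x'}`
as the localization of `B_j` at `𝔴`, and `𝔴` lies over the maximal ideal of `𝒪_{X,s}`.
[cite: StacksProject, Tag 0804] -/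
theorem IsBlowup.exists_reesChart_stalk (hπ : IsBlowup π J) (x' : X') {k : ℕ}
    (c : Fin k → X.presheaf.stalk (π x'))
    (hc : Ideal.span (Set.range c) = stalkIdeal J (π x')) :
    ∃ (j : Fin k) (𝔴 : PrimeSpectrum (chartRing c j))
      (χ : chartRing c j →+* X'.presheaf.stalk x'),
      (∀ a, χ (chartBase c j a) = (π.stalkMap x').hom a) ∧
      @IsLocalization.AtPrime _ _ (X'.presheaf.stalk x') _ χ.toAlgebra 𝔴.asIdeal _ ∧
      𝔴.asIdeal.comap (chartBase c j) = maximalIdeal (X.presheaf.stalk (π x')) := by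
  obtain ⟨j, w, q, hq, hiso, hsq⟩ := hπ.exists_chart_morphism x' c hc
  haveI := hiso
  obtain ⟨χ, h1, h2, h3⟩ := exists_stalk_ringHom_of_chart π x' _ q w hq hsq
  exact ⟨j, w, χ, h1, h2, h3⟩

end Chart

end Literature.AlgebraicGeometry.Resolution

end
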